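import Summits.Ventures.Crystal3D.Theorems.StickyWulffConstantNoReconstructionGainJointBoundLayered
import Summits.Ventures.Crystal3D.Theorems.StickyWulffConstantNoReconstructionGainJointBoundDeepHeavy
import Summits.Ventures.Crystal3D.Theorems.StickyWulffConstantNoReconstructionGainJointBoundLevelHeavy
import Summits.Ventures.Crystal3D.Theorems.StickyWulffConstantNoReconstructionGainCubeCap
import HarnessLib

/-!
# Joint level/support bound — the rung: layered films gain nothing (line `joint-level-support-bound`)

HONEST FRAMING. Part of the venture `Summits/Ventures/Crystal3D` (cell `crystal3d-full`), supports the
crux `NoReconstructionGain` (stmt-Ventures-19144, route `route-Ventures-StickyWulffConstant`), line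
`joint-level-support-bound` (skeleton v3).  The line's three landed stubs assembled into its RUNG:

* `jointBound_half_twentieth` — **JB(1/2, 1/20)**: for every unit axis `ν` and every finite set of
  unit vectors with pairwise inner products `≤ 1/2` (the contact directions of one ball of a unit
  packing), `2·#{u : ⟪u,ν⟫ ≤ -1/2} + #{u : |⟪u,ν⟫| ≤ 1/20} ≤ 12`.  Tight at the three F-faces of fcc:
  (111) gives (3, 6), (100) gives (4, 4), (110) gives (5, 2).  From `stub_jointBound_deepHeavy`
  (deep-heavy rows, β = 1/10 ⊇ 1/20), `stub_jointBound_levelHeavy20` (level-heavy row) and the landed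
  thin-band count `card_thin_band_le_six_axis`.
* `layeredFilm20_adhesion` — **the adhesion atom with `C = 0` for every (1/2, 1/20)-layered film at
  every normal**: if the film `X \ P` over the substrate `P` carries an integer layer index `L` such
  that from every non-exempt film ball substrate partners and lower-layer partners are `1/2`-deep along
  `ν` and same-layer partners are `1/20`-level, then `#cross(P, X \ P) ≤ contactDeficiency (X \ P) + 6·#E`
  (`stub_layeredAdhesion_of_jointBound` at `(t, β) = (1/2, 1/20)`).  Every (111)-, (100)- or (110)-type
  stacking aligned with the slab — ordered or disordered in the stacking sequence, rumpled by up to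
  `1/20` per layer — is such a film with `E = ∅`.

WHAT THIS IS NOT: the crux — films admitting no such layering (misoriented grains beyond the landed
grain rungs, genuinely three-dimensional disordered cores) are the registered residual
`stub_adhesion_nonLayeredCore`; rung F-C1 not moved by this file alone.
-/

noncomputable section

namespace Summit.Ventures.Crystal3D.Theorems

open Finset
open Literature.MathematicalPhysics.StatisticalMechanics (contactDeficiency)
open scoped InnerProductSpace

/-- **JB(1/2, 1/20).**  For a unit axis `ν` and a finite set `U` of unit vectors with pairwise inner
products `≤ 1/2`: `2·#{u : ⟪u, ν⟫ ≤ -1/2} + #{u : |⟪u, ν⟫| ≤ 1/20} ≤ 12`. -/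
theorem jointBound_half_twentieth (ν : EuclideanSpace ℝ (Fin 3)) (hν : ‖ν‖ = 1)
    (U : Finset (EuclideanSpace ℝ (Fin 3))) (hU : ∀ u ∈ U, ‖u‖ = 1)
    (hsep : ∀ u ∈ U, ∀ w ∈ U, u ≠ w → ⟪u, w⟫_ℝ ≤ 1 / 2) :
    2 * (U.filter fun u => ⟪u, ν⟫_ℝ ≤ -(1 / 2)).card
      + (U.filter fun u => |⟪u, ν⟫_ℝ| ≤ 1 / 20).card ≤ 12 := by
  classical
  have hr : (U.filter fun u => |⟪u, ν⟫_ℝ| ≤ 1 / 20).card ≤ 6 :=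
    card_thin_band_le_six_axis ν hν (fun u hu => hU u (mem_filter.1 hu).1)
      (fun u hu => ((mem_filter.1 hu).2).trans (by norm_num))
      (fun u hu w hw huw => hsep u (mem_filter.1 hu).1 w (mem_filter.1 hw).1 huw)
  have hmono : (U.filter fun u => |⟪u, ν⟫_ℝ| ≤ 1 / 20).card ≤
      (U.filter fun u => |⟪u, ν⟫_ℝ| ≤ 1 / 10).card :=
    card_le_card fun u hu => mem_filter.2 ⟨(mem_filter.1 hu).1, ((mem_filter.1 hu).2).trans (by norm_num)⟩
  by_cases h5 : 5 ≤ (U.filter fun u => ⟪u, ν⟫_ℝ ≤ -(1 / 2)).card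
  · have := stub_jointBound_deepHeavy ν hν U hU hsep h5
    omega
  · by_cases r5 : 5 ≤ (U.filter fun u => |⟪u, ν⟫_ℝ| ≤ 1 / 20).card
    · have := stub_jointBound_levelHeavy20 ν hν U hU hsep r5
      omega
    · omega

/-- **The rung of the line: (1/2, 1/20)-layered films gain nothing.**  `X` a finite unit packing,
`P ⊆ X` the substrate, `E ⊆ X \ P` an exempt set, `ν` a unit normal, `L` an integer layer index such
that from every film ball `q ∉ E` each substrate partner `y` has `⟪y - q, ν⟫ ≤ -1/2`, each film partner
on a lower layer (`L y < L q`) has `⟪y - q, ν⟫ ≤ -1/2`, and each film partner on the same layer has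
`|⟪y - q, ν⟫| ≤ 1/20`.  Then `#cross(P, X \ P) ≤ contactDeficiency (X \ P) + 6·#E`. -/
theorem layeredFilm20_adhesion (ν : EuclideanSpace ℝ (Fin 3)) (hν : ‖ν‖ = 1)
    (X P E : Finset (EuclideanSpace ℝ (Fin 3)))
    (hX : ∀ p ∈ X, ∀ q ∈ X, p ≠ q → 1 ≤ dist p q) (hPX : P ⊆ X) (hE : E ⊆ X \ P)
    (L : EuclideanSpace ℝ (Fin 3) → ℤ)
    (hL : ∀ q ∈ (X \ P) \ E, ∀ y ∈ X, dist q y = 1 →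
      (y ∈ P → ⟪y - q, ν⟫_ℝ ≤ -(1 / 2)) ∧
      (y ∉ P → (L y = L q → |⟪y - q, ν⟫_ℝ| ≤ 1 / 20) ∧ (L y < L q → ⟪y - q, ν⟫_ℝ ≤ -(1 / 2)))) :
    ((((P ×ˢ (X \ P)).filter fun pq => dist pq.1 pq.2 = 1).card : ℕ) : ℝ) ≤
      contactDeficiency (X \ P) + 6 * (E.card : ℝ) :=
  stub_layeredAdhesion_of_jointBound (1 / 2) (1 / 20)
    (fun μ hμ U hU hsep => jointBound_half_twentieth μ hμ U hU hsep) ν hν X P E hX hPX hE L hL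

end Summit.Ventures.Crystal3D.Theorems

end
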